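import Summits.SmoothPoincare4.SmoothPoincare4.Theses.DottedCircleRasmussen
import Summits.SmoothPoincare4.SmoothPoincare4.Theorems.DottedCircleRasmussenDcrGfgmw
import Summits.SmoothPoincare4.SmoothPoincare4.Theorems.DcrGap.Negative.NoDiscNormalForm
import Summits.SmoothPoincare4.SmoothPoincare4.Theorems.DcrGap.Negative.NoEmbedding
import Summits.SmoothPoincare4.SmoothPoincare4.Theorems.DcrGap.Negative.KZeroIsFgmw
import Literature.Topology.FourManifolds.MMSWRasmussenFactsProofs
import Literature.Topology.FourManifolds.SliceDiscInTransport
import Literature.Topology.FourManifolds.SphereSimplyConnected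
import Literature.Topology.FourManifolds.HomotopyBallSliceSphereProofs
import Literature.Topology.FourManifolds.EquidimensionalEmbedding
import Literature.Topology.FourManifolds.ChartTransport
import Literature.Topology.FourManifolds.SliceRibbon
import Literature.Topology.FourManifolds.KnotsProofs

/-!
# Disproof of `DcrRigidity` — findings (crux stmt-SmoothPoincare4-17014, route `DottedCircleRasmussen`)

Standing disprover's work file (cdisprove, cycle 1).  The crux is the route's KILL SWITCH

  `DcrRigidity := ¬ DcrGap`   (by name),

so a DISPROOF of it is — word for word — a PROOF of the one-handle slice gap `DcrGap`: a model
knot `K ⊂ ∂D_k`, a smooth homotopy 4-sphere `M` (Statement binders) carrying a slice datum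
`(e, f)` for `K` off `e(D_k)`, and the no-disc clause over every smooth `N ≅ S⁴`.  Read as a
`∀`-statement (`not_dcrGap_iff_membershipOnly`, `Theorems.DcrGap.Negative.dcrRigidity_iff_modelForm`):
"every circle `K ⊂ ∂D_k` that is slice off `e(D_k)` in SOME homotopy 4-sphere bounds a smooth
proper disc in `ℝ⁴ ∖ D_k`".

## Findings (index; details in the docstrings)

* §0 SHAPE.  `¬ DcrRigidity ↔ DcrGap` (`not_not`); normal form of a disproof
  (`not_dcrRigidity_iff_modelForm`: NO model slice disc in `ℝ⁴ ∖ D_k`); a disproof disproves the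
  summit (`not_spc4_of_not_dcrRigidity`); the cheapest conceivable disproof is an FGMW certificate
  at `k = 0` (`not_dcrRigidity_of_isHomotopyBallSlice_not_isSmoothlySlice`).  VERDICT: no kill is
  available — a kill is an exotic `S⁴` detected by a dotted-circle slice gap.
* §1 LOAD-BEARING ANALYSIS (all PROVED, landed as `Theorems/DcrRigidity/Negative/LoadBearing.lean`,
  p131480):
  - the regularity clauses of `IsModelKnot` (smooth / injective / immersed) are IMPLIED by the
    datum (`isModelKnot_of_isSliceDiscInComplement`), so the kill switch with `IsModelKnot`
    weakened to bare membership `K ⊂ ∂D_k` is the SAME statement (`not_dcrGap_iff_membershipOnly`)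
    — "hypotheses possibly unnecessary": yes, provably;
  - weakening the conclusion's `N ≃ₘ S⁴` to `N ≃ₕ S⁴`: trivially true, `N := M`
    (`exists_up_to_homotopyEquiv`) — ALL content is in the smooth structure of `N`;
  - strengthening the conclusion to the literal `S⁴`, its Mathlib atlas and THE round chart
    `(chartAt a)⁻¹`: still the same statement (`not_dcrGap_iff_roundChart`; Palais absorbs carrier,
    atlas, chart and chirality) — no normalisation is missing, nothing to exploit either way;
  - non-vacuity: the hypothesis class is inhabited at `k = 0` (unknot datum,
    `exists_isModelKnot_zero_slice`), so the crux is not true for want of data.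
* §2 HOW EXOTIC A WITNESS MUST BE (all PROVED, landed as
  `Theorems/DcrRigidity/Negative/NonInvertibleWitness.lean`, p131296): a disproof yields a homotopy
  sphere `M` that is exotic (`exists_exotic_of_not_dcrRigidity`) AND NON-INVERTIBLE — no puncture
  `M ∖ {q}` embeds smoothly in `S⁴` or `ℝ⁴`, for ANY `q` (`exists_nonInvertible_of_not_dcrRigidity`,
  `…_euclidean`, `not_forall_punctureEmbeds_of_not_dcrRigidity`).  By FGMW's splitting
  `SPC4 ⟺ INV ∧ Schoenflies⁴` the disproof must break the INVERTIBILITY half; every candidate of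
  the route's engine (`DcrRasmussenWitness`) dies as soon as one puncture of its sphere embeds in
  `ℝ⁴` — an invariant-free calibration test to run BEFORE any `s`-computation.  Geometric input,
  proved here for `D_k` as the tree proves it for the unit ball: `congr_chart`, shrink the chart
  outside `B̄(0, 40(k+1)+1)`, move a datum off any point (dimension count + Milnor homogeneity),
  corestrict, transplant along a smooth embedding of the puncture.
* §3 GENUINELY LOAD-BEARING HYPOTHESES = NEAR-MISSES (sorried, obstruction recorded): dropping
  `M ≃ₕ S⁴` on the carrier (`rigidity_false_without_homotopySphere`) or the avoidance clause
  `f(𝔻°) ∩ e(D_k) = ∅` of the hypothesis datum (`rigidity_false_without_avoidance`) makes the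
  statement FALSE in print (trefoil: Norman trick / a disc through `D_k`, versus MMSW Lemma 8.19
  `s = 2`), but the tree has NO unconditional slice obstruction (Rasmussen's `s(slice) = 0` is the
  named fact `eq_zero_of_isSmoothlySlice`, undischarged; no `M_k`-obstruction at all), so neither
  `_false_without_` theorem can be closed today.  Stated modulo the FGMW-style facts they need.
* §4 WHY IT RESISTS (prose at the end): the crux is a clean dichotomy one level below SPC4 —
  `SPC4 ⇒ INV ⇒ DcrRigidity ⇒ (H-slice ⇒ slice)`, all four open; every weakening is trivial and
  every strengthening equivalent; a kill needs (i) a non-invertible homotopy 4-sphere and (ii) a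
  certificate that one of its dotted-circle attaching knots bounds no disc in `ℝ⁴ ∖ D_k` — in
  print only MMSW's `s_±` can certify (ii), and no computation of `s_±` on a live candidate exists
  (MMSW Cor. 1.13: Gluck twists are blind; Question 9.11 open at `k = 0`).

Sibling resources used: `Cruxes/DcrGap/Disproof.lean` (normal forms §1, shield §3, `k = 0` pin §4),
landed `Theorems/DcrGap/Negative/{NoDiscNormalForm, NoEmbedding, KZeroIsFgmw}.lean`,
`Cruxes/DcrRigidity/{SketchIdeator2.lean, IdeatorR1K2Notes.md, Ideas/*.md}` (the transplant of card
`invertible-sphere-transplant` is PROVED here in full: its sorried `dcrRigidity_of_invertible` is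
`not_forall_punctureEmbeds_of_not_dcrRigidity` read contrapositively).
-/

noncomputable section

-- namespace prescribed by the crux protocol (`P = Sub = SmoothPoincare4`)
set_option linter.dupNamespace false

open scoped Manifold ContDiff Topology
open Function Set Metric Module
open Literature.Topology.FourManifolds Literature.Topology.FourManifolds.MMSW
open Summit.SmoothPoincare4.SmoothPoincare4.Theses.DottedCircleRasmussen

namespace Summit.SmoothPoincare4.SmoothPoincare4.Cruxes.DcrRigidity.Disproof


/-! ## §0 The shape of a disproof -/

/-- **A disproof of the kill switch is a proof of the one-handle slice gap**, by name
(`DcrRigidity := ¬ DcrGap`). [folklore] -/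
theorem not_dcrRigidity_iff : ¬ DcrRigidity ↔ DcrGap := not_not

/-- **… in normal form**: some model knot `K ⊂ ∂D_k` is slice off `e(D_k)` in some homotopy
4-sphere but bounds NO smooth proper disc in `ℝ⁴ ∖ D_k` (all carrier / atlas / chart / chirality
freedom of the no-disc clause absorbed by Palais' disc theorem; landed
`Theorems.DcrGap.Negative.dcrGap_iff_modelForm`). [cite: Palais1960, Thm. B] -/
theorem not_dcrRigidity_iff_modelForm :
    ¬ DcrRigidity ↔ ∃ (k : ℕ)
      (K : (Metric.sphere (0 : EuclideanSpace ℝ (Fin 2)) 1) → EuclideanSpace ℝ (Fin 4)),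
      IsModelKnot k K ∧
      (∃ (M : Type) (_ : TopologicalSpace M) (_ : T2Space M) (_ : SecondCountableTopology M)
          (_ : ChartedSpace (EuclideanSpace ℝ (Fin 4)) M) (_ : IsManifold (𝓡 4) ∞ M),
          Nonempty (ContinuousMap.HomotopyEquiv M (Metric.sphere (0 : EuclideanSpace ℝ (Fin 5)) 1)) ∧
            ∃ (e : EuclideanSpace ℝ (Fin 4) → M) (f : EuclideanSpace ℝ (Fin 2) → M),
              IsSliceDiscInComplement k K M e f) ∧
      ∀ g, ¬ IsModelSliceDisc k K g :=
  not_not.trans Theorems.DcrGap.Negative.dcrGap_iff_modelForm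

/-- **A disproof of the kill switch disproves the summit** (`SmoothPoincare4 → DcrRigidity` is the
contrapositive of the route's certified deciding theorem `closes`). [folklore] -/
theorem not_spc4_of_not_dcrRigidity (h : ¬ DcrRigidity) : ¬ _root_.SmoothPoincare4 :=
  fun hS => h fun hX => closes hX hS

/-- **The cheapest conceivable disproof is an FGMW certificate**: a knot that is slice in a
homotopy 4-ball but not in `B⁴` refutes the kill switch (its `k = 0` layer; contrapositive of the
landed `Theorems.DcrGap.Negative.isSmoothlySlice_of_isHomotopyBallSlice_of_not_dcrGap`).
[cite: FreedmanGompfMorrisonWalker2010, §1] -/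
theorem not_dcrRigidity_of_isHomotopyBallSlice_not_isSmoothlySlice (K : Knot)
    (hb : K.IsHomotopyBallSlice) (hs : ¬ K.IsSmoothlySlice) : ¬ DcrRigidity := fun hR =>
  hs (Theorems.DcrGap.Negative.isSmoothlySlice_of_isHomotopyBallSlice_of_not_dcrGap hR K hb)



/-! ## §1 Load-bearing analysis

### §1a The regularity clauses of `IsModelKnot` are implied by the datum -/

section DatumRegularity

variable {X : Type*} [TopologicalSpace X] [ChartedSpace (EuclideanSpace ℝ (Fin 4)) X] {k : ℕ}
  {K : (Metric.sphere (0 : EuclideanSpace ℝ (Fin 2)) 1) → EuclideanSpace ℝ (Fin 4)}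
  {e : EuclideanSpace ℝ (Fin 4) → X} {f : EuclideanSpace ℝ (Fin 2) → X}

/-- **A circle carrying a slice datum is automatically a smooth embedded circle.** If `(e, f)` is
a slice datum for `K` (`MMSW.IsSliceDiscInComplement k K X e f`: `e` a smooth chart `ℝ⁴ ↪ X`,
`f|_{𝔻²}` a smooth embedded disc with `f|_{S¹} = e ∘ K`), then `K` is `C^∞`, injective and immersed:
`K = Φ ∘ f|_{S¹}` for the smooth inverse `Φ` of `e` on its open range
(`exists_chart_of_isSmoothEmbedding`), `f` is injective on `S¹ ⊂ 𝔻²`, and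
`de ∘ dK = d(f|_{S¹}) = df ∘ d(incl)` is injective. With membership `K ⊂ ∂D_k` this is
`IsModelKnot k K`. [folklore] -/
theorem isModelKnot_of_isSliceDiscInComplement [IsManifold (𝓡 4) ∞ X]
    (h : IsSliceDiscInComplement k K X e f) (hK : ∀ t, K t ∈ modelBoundary k) :
    IsModelKnot k K := by
  obtain ⟨he, hf, hinj, hmf, -, hbdry⟩ := h
  obtain ⟨Φ, hΦt, hΦe, hΦs, hΦc⟩ := exists_chart_of_isSmoothEmbedding he
  haveI : Fact (finrank ℝ (EuclideanSpace ℝ (Fin 2)) = 1 + 1) := ⟨finrank_euclideanSpace_fin⟩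
  have hval : ContMDiff (𝓡 1) (𝓡 2) ∞
      (fun t : Metric.sphere (0 : EuclideanSpace ℝ (Fin 2)) 1 => (t : EuclideanSpace ℝ (Fin 2))) :=
    contMDiff_coe_sphere
  have hfv : ContMDiff (𝓡 1) (𝓡 4) ∞
      (fun t : Metric.sphere (0 : EuclideanSpace ℝ (Fin 2)) 1 => f t) := hf.comp hval
  have hsrc : ∀ t : Metric.sphere (0 : EuclideanSpace ℝ (Fin 2)) 1, f t ∈ Φ.source := fun t => by
    rw [hΦs, hbdry t]
    exact ⟨K t, rfl⟩
  have hKeq : ∀ t : Metric.sphere (0 : EuclideanSpace ℝ (Fin 2)) 1, Φ (f t) = K t := fun t => by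
    rw [hbdry t, ← hΦe]
    exact Φ.right_inv (by rw [hΦt]; exact mem_univ _)
  have hKs : ContMDiff (𝓡 1) 𝓘(ℝ, EuclideanSpace ℝ (Fin 4)) ∞ K :=
    (hΦc.comp_contMDiff hfv hsrc).congr fun t => (hKeq t).symm
  have hKinj : Injective K := fun t₁ t₂ ht => by
    have h1 : f t₁ = f t₂ := by rw [hbdry, hbdry, ht]
    exact Subtype.ext (hinj (sphere_subset_closedBall t₁.2) (sphere_subset_closedBall t₂.2) h1)
  refine ⟨hKs, hKinj, fun t => ?_, hK⟩
  have hcomp : (fun t : Metric.sphere (0 : EuclideanSpace ℝ (Fin 2)) 1 => f t) = e ∘ K :=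
    funext fun t => hbdry t
  have h1 : MDifferentiableAt (𝓡 1) 𝓘(ℝ, EuclideanSpace ℝ (Fin 4)) K t :=
    hKs.mdifferentiableAt (by simp)
  have h2 : MDifferentiableAt 𝓘(ℝ, EuclideanSpace ℝ (Fin 4)) (𝓡 4) e (K t) :=
    he.contMDiff.mdifferentiableAt (by simp)
  have h3 : MDifferentiableAt (𝓡 1) (𝓡 2)
      (fun t : Metric.sphere (0 : EuclideanSpace ℝ (Fin 2)) 1 => (t : EuclideanSpace ℝ (Fin 2))) t :=
    hval.mdifferentiableAt (by simp)
  have h4 : MDifferentiableAt (𝓡 2) (𝓡 4) f (t : EuclideanSpace ℝ (Fin 2)) :=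
    hf.mdifferentiableAt (by simp)
  have key : Injective (mfderiv (𝓡 1) (𝓡 4) (e ∘ K) t) := by
    rw [← hcomp, show (fun t : Metric.sphere (0 : EuclideanSpace ℝ (Fin 2)) 1 => f t) =
      f ∘ (fun t : Metric.sphere (0 : EuclideanSpace ℝ (Fin 2)) 1 => (t : EuclideanSpace ℝ (Fin 2)))
      from rfl, mfderiv_comp t h4 h3]
    exact (hmf _ (sphere_subset_closedBall t.2)).comp
      (mfderiv_coe_sphere_injective (E := EuclideanSpace ℝ (Fin 2)) (n := 1) t)
  rw [mfderiv_comp t h2 h1] at key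
  intro v w hvw
  apply key
  change (mfderiv 𝓘(ℝ, EuclideanSpace ℝ (Fin 4)) (𝓡 4) e (K t))
      ((mfderiv (𝓡 1) 𝓘(ℝ, EuclideanSpace ℝ (Fin 4)) K t) v) =
    (mfderiv 𝓘(ℝ, EuclideanSpace ℝ (Fin 4)) (𝓡 4) e (K t))
      ((mfderiv (𝓡 1) 𝓘(ℝ, EuclideanSpace ℝ (Fin 4)) K t) w)
  rw [hvw]

/-- **Weakening the conclusion to homotopy equivalence makes the kill switch trivially true**:
given a datum in a homotopy sphere `M`, the carrier `N := M` itself is "some `N ≃ₕ S⁴` with a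
datum". So all content of the kill switch sits in the DIFFEOMORPHISM `N ≃ₘ S⁴` of its conclusion
(dual of the landed `Theorems.DcrGap.Negative.dcrGap_false_without_diffeo`). [folklore] -/
theorem exists_up_to_homotopyEquiv (k : ℕ)
    (K : (Metric.sphere (0 : EuclideanSpace ℝ (Fin 2)) 1) → EuclideanSpace ℝ (Fin 4))
    (M : Type) [TopologicalSpace M] [T2Space M] [SecondCountableTopology M]
    [ChartedSpace (EuclideanSpace ℝ (Fin 4)) M] [IsManifold (𝓡 4) ∞ M]
    (hM : Nonempty (ContinuousMap.HomotopyEquiv M (Metric.sphere (0 : EuclideanSpace ℝ (Fin 5)) 1)))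
    (e : EuclideanSpace ℝ (Fin 4) → M) (f : EuclideanSpace ℝ (Fin 2) → M)
    (h : IsSliceDiscInComplement k K M e f) :
    ∃ (N : Type) (_ : TopologicalSpace N) (_ : T2Space N) (_ : SecondCountableTopology N)
      (_ : ChartedSpace (EuclideanSpace ℝ (Fin 4)) N) (_ : IsManifold (𝓡 4) ∞ N),
      Nonempty (ContinuousMap.HomotopyEquiv N (Metric.sphere (0 : EuclideanSpace ℝ (Fin 5)) 1)) ∧
        ∃ (e' : EuclideanSpace ℝ (Fin 4) → N) (f' : EuclideanSpace ℝ (Fin 2) → N),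
          IsSliceDiscInComplement k K N e' f' :=
  ⟨M, _, ‹_›, ‹_›, _, ‹_›, hM, e, f, h⟩

end DatumRegularity

/-! ### §1b The kill switch with `IsModelKnot` weakened to membership is the same statement -/

/-- **Only the membership clause of `IsModelKnot` is independent**: `¬ DcrGap` (the kill switch,
in the landed normal form) is EQUIVALENT to its version for arbitrary maps `K : S¹ → ∂D_k` — the
regularity clauses come for free with the datum (`isModelKnot_of_isSliceDiscInComplement`).
Information for provers: nothing is gained or lost by the smooth/injective/immersed hypotheses.
[folklore] -/
theorem not_dcrGap_iff_membershipOnly :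
    ¬ DcrGap ↔ ∀ (k : ℕ)
      (K : (Metric.sphere (0 : EuclideanSpace ℝ (Fin 2)) 1) → EuclideanSpace ℝ (Fin 4)),
      (∀ t, K t ∈ modelBoundary k) →
      (∃ (M : Type) (_ : TopologicalSpace M) (_ : T2Space M) (_ : SecondCountableTopology M)
          (_ : ChartedSpace (EuclideanSpace ℝ (Fin 4)) M) (_ : IsManifold (𝓡 4) ∞ M),
          Nonempty (ContinuousMap.HomotopyEquiv M (Metric.sphere (0 : EuclideanSpace ℝ (Fin 5)) 1)) ∧
            ∃ (e : EuclideanSpace ℝ (Fin 4) → M) (f : EuclideanSpace ℝ (Fin 2) → M),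
              IsSliceDiscInComplement k K M e f) →
      ∃ g, IsModelSliceDisc k K g := by
  rw [Theorems.DcrGap.Negative.dcrRigidity_iff_modelForm]
  refine forall₂_congr fun k K => ⟨fun h hK hS => ?_, fun h hK hS => h hK.mem hS⟩
  obtain ⟨M, _, _, _, _, _, hM, e, f, hef⟩ := hS
  exact h (isModelKnot_of_isSliceDiscInComplement hef hK) ⟨M, _, ‹_›, ‹_›, _, ‹_›, hM, e, f, hef⟩

/-! ### §1c Strengthening the conclusion to the round chart of the literal `S⁴` changes nothing -/

/-- **No freedom of the conclusion is exploitable, in either direction**: `¬ DcrGap` is equivalent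
to the version whose conclusion names the literal unit sphere `S⁴ ⊂ ℝ⁵`, its Mathlib atlas and
THE round chart `(chartAt a)⁻¹` at a fixed point `a` — a datum `((chartAt a)⁻¹, f')`. (`→`: the
model slice disc of the normal form pushed along the round chart,
`IsModelSliceDisc.isSliceDiscInComplement_chartAt_symm`; `←`: a datum in `S⁴` with any chart is
standardised, landed `Theorems.DcrGap.Negative.noDisc_iff_forall_not_isModelSliceDisc`.)
[cite: Palais1960, Thm. B] -/
theorem not_dcrGap_iff_roundChart (a : Metric.sphere (0 : EuclideanSpace ℝ (Fin 5)) 1) :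
    ¬ DcrGap ↔ ∀ (k : ℕ)
      (K : (Metric.sphere (0 : EuclideanSpace ℝ (Fin 2)) 1) → EuclideanSpace ℝ (Fin 4)),
      IsModelKnot k K →
      (∃ (M : Type) (_ : TopologicalSpace M) (_ : T2Space M) (_ : SecondCountableTopology M)
          (_ : ChartedSpace (EuclideanSpace ℝ (Fin 4)) M) (_ : IsManifold (𝓡 4) ∞ M),
          Nonempty (ContinuousMap.HomotopyEquiv M (Metric.sphere (0 : EuclideanSpace ℝ (Fin 5)) 1)) ∧
            ∃ (e : EuclideanSpace ℝ (Fin 4) → M) (f : EuclideanSpace ℝ (Fin 2) → M),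
              IsSliceDiscInComplement k K M e f) →
      ∃ f' : EuclideanSpace ℝ (Fin 2) → Metric.sphere (0 : EuclideanSpace ℝ (Fin 5)) 1,
        IsSliceDiscInComplement k K (Metric.sphere (0 : EuclideanSpace ℝ (Fin 5)) 1)
          (chartAt (EuclideanSpace ℝ (Fin 4)) a).symm f' := by
  rw [Theorems.DcrGap.Negative.dcrRigidity_iff_modelForm]
  refine forall₂_congr fun k K => imp_congr_right fun hK => imp_congr_right fun _ => ⟨?_, ?_⟩
  · rintro ⟨g, hg⟩
    exact ⟨_, hg.isSliceDiscInComplement_chartAt_symm a⟩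
  · rintro ⟨f', hf'⟩
    by_contra hno
    push Not at hno
    exact Theorems.DcrGap.Negative.noDisc_of_forall_not_isModelSliceDisc hK.mem hno _
      ⟨Diffeomorph.refl _ _ _⟩ _ _ hf'

/-! ### §1d Non-vacuity: the hypothesis class is inhabited at `k = 0` -/

/-- **The kill switch is not vacuously true**: already with no dotted circle there is a model knot
with a slice datum in a homotopy 4-sphere — the unknot rescaled onto the ellipsoid `∂D_0 = L(S³)`,
`L = diag(40, 40, 1, 1)` (landed `Theorems.DcrGap.Negative.exists_scaling`, `isModelKnot_scaling_comp`),
whose flat slice disc pushed into `S⁴` (`isSmoothlySlice_unknot`,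
`Knot.IsSmoothlySlice.isHomotopyBallSlice_holds`) is a `k = 0` datum by the landed dictionary
`isSliceDiscInComplement_zero_of_isSliceDiscIn`. [cite: ManolescuPiccirillo2023, §2] -/
theorem exists_isModelKnot_zero_slice :
    ∃ K : (Metric.sphere (0 : EuclideanSpace ℝ (Fin 2)) 1) → EuclideanSpace ℝ (Fin 4),
      IsModelKnot 0 K ∧
      ∃ (M : Type) (_ : TopologicalSpace M) (_ : T2Space M) (_ : SecondCountableTopology M)
        (_ : ChartedSpace (EuclideanSpace ℝ (Fin 4)) M) (_ : IsManifold (𝓡 4) ∞ M),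
        Nonempty (ContinuousMap.HomotopyEquiv M (Metric.sphere (0 : EuclideanSpace ℝ (Fin 5)) 1)) ∧
          ∃ (e : EuclideanSpace ℝ (Fin 4) → M) (f : EuclideanSpace ℝ (Fin 2) → M),
            IsSliceDiscInComplement 0 K M e f := by
  obtain ⟨L, hL⟩ := Theorems.DcrGap.Negative.exists_scaling
  have hD := Theorems.DcrGap.Negative.scaling_mem_modelHandlebody_zero_iff hL
  obtain ⟨M, _, _, _, _, _, _, hM, e, f, hef⟩ :=
    Knot.IsSmoothlySlice.isHomotopyBallSlice_holds unknot isSmoothlySlice_unknot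
  exact ⟨_, Theorems.DcrGap.Negative.isModelKnot_scaling_comp hL unknot, M, _, ‹_›, ‹_›, _, ‹_›, hM, _, f,
    Theorems.DcrGap.Negative.isSliceDiscInComplement_zero_of_isSliceDiscIn hD hef⟩

/-- **… hence any proof of the kill switch must PRODUCE model slice discs** (it cannot hold for
want of hypotheses), and dually a disproof must produce a datum with NO model slice disc — for
the `k = 0` datum above the flat disc is one, so the unknot is never a witness
(landed `Theorems.DcrGap.Negative.not_noDisc_of_isModelSliceDisc`). Stated: the normal form's hypothesis
is met at least once. [folklore] -/
theorem exists_hypotheses_of_modelForm :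
    ∃ (k : ℕ) (K : (Metric.sphere (0 : EuclideanSpace ℝ (Fin 2)) 1) → EuclideanSpace ℝ (Fin 4)),
      IsModelKnot k K ∧
      ∃ (M : Type) (_ : TopologicalSpace M) (_ : T2Space M) (_ : SecondCountableTopology M)
        (_ : ChartedSpace (EuclideanSpace ℝ (Fin 4)) M) (_ : IsManifold (𝓡 4) ∞ M),
        Nonempty (ContinuousMap.HomotopyEquiv M (Metric.sphere (0 : EuclideanSpace ℝ (Fin 5)) 1)) ∧
          ∃ (e : EuclideanSpace ℝ (Fin 4) → M) (f : EuclideanSpace ℝ (Fin 2) → M),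
            IsSliceDiscInComplement k K M e f :=
  ⟨0, exists_isModelKnot_zero_slice⟩

/-! ## §2 How exotic a witness must be

### §2a Re-choosing a slice datum off a point -/

section Datum

variable {X : Type*} [TopologicalSpace X] [ChartedSpace (EuclideanSpace ℝ (Fin 4)) X] {k : ℕ}
  {K : (Metric.sphere (0 : EuclideanSpace ℝ (Fin 2)) 1) → EuclideanSpace ℝ (Fin 4)}
  {e : EuclideanSpace ℝ (Fin 4) → X} {f : EuclideanSpace ℝ (Fin 2) → X}

/-- **Slice data only see the chart on the ball `B̄(0, 40(k+1)+1) ⊇ D_k`.** If `(e, f)` is a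
slice datum for the circle `K ⊂ ∂D_k` and `e'` is another smooth embedding `ℝ⁴ ↪ X` agreeing with
`e` on that closed ball, then `(e', f)` is a slice datum too: `e'(D_k) = e(D_k)`
(`Theorems.DcrGfgmw.norm_le_of_mem_modelHandlebody`) and `e' ∘ K = e ∘ K`. The `D_k`-analogue of the tree's
`Knot.IsSliceDiscIn.congr_ball`. [folklore] -/
theorem isSliceDiscInComplement_congr_chart (h : IsSliceDiscInComplement k K X e f)
    (hK : ∀ t, K t ∈ modelBoundary k) {e' : EuclideanSpace ℝ (Fin 4) → X}
    (he' : Manifold.IsSmoothEmbedding (𝓡 4) (𝓡 4) ∞ e')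
    (hee' : ∀ w, ‖w‖ ≤ 40 * ((k : ℝ) + 1) + 1 → e' w = e w) :
    IsSliceDiscInComplement k K X e' f := by
  obtain ⟨-, hf, hinj, hmf, hproper, hbdry⟩ := h
  have himg : e' '' modelHandlebody k = e '' modelHandlebody k := by
    refine Subset.antisymm ?_ ?_
    · rintro _ ⟨w, hw, rfl⟩
      exact ⟨w, hw, (hee' w (Theorems.DcrGfgmw.norm_le_of_mem_modelHandlebody hw)).symm⟩
    · rintro _ ⟨w, hw, rfl⟩
      exact ⟨w, hw, hee' w (Theorems.DcrGfgmw.norm_le_of_mem_modelHandlebody hw)⟩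
  refine ⟨he', hf, hinj, hmf, fun x hx => ?_, fun t => ?_⟩
  · rw [himg]
    exact hproper x hx
  · rw [hbdry t, hee' _ (Theorems.DcrGfgmw.norm_le_of_mem_modelHandlebody
      (modelBoundary_subset_modelHandlebody (hK t)))]

/-- **Shrinking a chart outside a closed ball.** For every smooth embedding `e : ℝ⁴ ↪ X` and every
`R > 0` there is a smooth embedding `e' : ℝ⁴ ↪ X` which AGREES with `e` on `B̄(0, R)` and whose
whole range lies in `e(B(0, 8R))`: conjugate the tree's `exists_isSmoothEmbedding_eqOn_ball`
(agreement on `B(0, 8)`, range in the image of `B(0, 32)`) by the homothety of ratio `R/4`.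
[folklore] -/
theorem exists_isSmoothEmbedding_eqOn_closedBall [IsManifold (𝓡 4) ∞ X]
    (he : Manifold.IsSmoothEmbedding (𝓡 4) (𝓡 4) ∞ e) {R : ℝ} (hR : 0 < R) :
    ∃ e' : EuclideanSpace ℝ (Fin 4) → X, Manifold.IsSmoothEmbedding (𝓡 4) (𝓡 4) ∞ e' ∧
      (∀ w, ‖w‖ ≤ R → e' w = e w) ∧ range e' ⊆ e '' ball 0 (8 * R) := by
  obtain ⟨c, hc⟩ : ∃ c : ℝ, c = R / 4 := ⟨_, rfl⟩
  have hc0 : 0 < c := by rw [hc]; positivity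
  set L : EuclideanSpace ℝ (Fin 4) ≃L[ℝ] EuclideanSpace ℝ (Fin 4) :=
    ContinuousLinearEquiv.equivOfInverse
      (c • ContinuousLinearMap.id ℝ (EuclideanSpace ℝ (Fin 4)))
      (c⁻¹ • ContinuousLinearMap.id ℝ (EuclideanSpace ℝ (Fin 4)))
      (fun w => by simp [smul_smul, hc0.ne']) (fun w => by simp [smul_smul, hc0.ne']) with hL
  have hLw : ∀ w, L w = c • w := fun w => rfl
  have hLsw : ∀ w, L.symm w = c⁻¹ • w := fun w => rfl
  have h1 : Manifold.IsSmoothEmbedding (𝓡 4) (𝓡 4) ∞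
      (e ∘ (L : EuclideanSpace ℝ (Fin 4) → EuclideanSpace ℝ (Fin 4))) :=
    he.comp_diffeomorph L.toDiffeomorph
  obtain ⟨e₁, he₁, hee₁, hr₁⟩ := exists_isSmoothEmbedding_eqOn_ball h1
  refine ⟨e₁ ∘ (L.symm : EuclideanSpace ℝ (Fin 4) → EuclideanSpace ℝ (Fin 4)),
    he₁.comp_diffeomorph L.symm.toDiffeomorph, fun w hw => ?_, ?_⟩
  · have hlt : ‖L.symm w‖ < 8 := by
      rw [hLsw, norm_smul, norm_inv, Real.norm_of_nonneg hc0.le, inv_mul_lt_iff₀ hc0]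
      rw [hc]
      linarith [norm_nonneg w]
    change e₁ (L.symm w) = e w
    rw [hee₁ _ hlt]
    change e (L (L.symm w)) = e w
    rw [L.apply_symm_apply]
  · rintro _ ⟨w, rfl⟩
    obtain ⟨u, hu, hu'⟩ := hr₁ ⟨L.symm w, rfl⟩
    refine ⟨L u, ?_, hu'⟩
    rw [mem_ball_zero_iff] at hu ⊢
    rw [hLw, norm_smul, Real.norm_of_nonneg hc0.le]
    calc c * ‖u‖ < c * 32 := by gcongr
      _ = 8 * R := by rw [hc]; ring

/-- **Slice data with images in an open subset are slice data in the open submanifold**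
(corestriction of the chart, `Manifold.IsSmoothEmbedding.codRestrict_opens`; the manifold
derivative of a corestriction is that of the map, `mfderiv_codRestrict_opens_eq`). The
`D_k`-analogue of the tree's `Knot.IsSliceDiscIn.codRestrict`. [folklore] -/
theorem isSliceDiscInComplement_codRestrict [IsManifold (𝓡 4) ∞ X]
    (h : IsSliceDiscInComplement k K X e f) (U : TopologicalSpace.Opens X)
    (heU : ∀ v, e v ∈ U) (hfU : ∀ y, f y ∈ U) :
    IsSliceDiscInComplement k K U (fun v => (⟨e v, heU v⟩ : U))
      (fun y => (⟨f y, hfU y⟩ : U)) := by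
  obtain ⟨he, hf, hinj, hmf, hproper, hbdry⟩ := h
  refine ⟨he.codRestrict_opens U heU, (ContMDiff.subtypeVal_comp_iff U _).1 hf,
    fun x hx y hy hxy => hinj hx hy (congrArg Subtype.val hxy), fun x hx => ?_, fun x hx => ?_,
    fun x => Subtype.ext (hbdry x)⟩
  · rw [mfderiv_codRestrict_opens_eq (f := f) (g := fun y => (⟨f y, hfU y⟩ : U)) (fun y => rfl)
      ((hf x).mdifferentiableAt (by simp))]
    exact hmf x hx
  · rintro ⟨v, hv, hfv⟩
    exact hproper x hx ⟨v, hv, congrArg Subtype.val hfv⟩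

/-- **A slice datum can be moved off any point of a connected 4-manifold.** Given a slice datum
`(e, f)` for the circle `K ⊂ ∂D_k` in the connected smooth 4-manifold `X` and a point `x₀`, there
is a slice datum `(e', f')` for `K` in `X` whose chart and disc both miss `x₀`. Proof: shrink the
chart outside `B̄(0, R) ⊇ D_k`, `R = 40(k+1)+1` (`exists_isSmoothEmbedding_eqOn_closedBall`: range
in `e(B(0, 8R))`, datum unchanged by `isSliceDiscInComplement_congr_chart`); by the dimension count
(`exists_lt_norm_apply_notMem_range`) some `x₁ = e v`, `‖v‖ > 8R`, is neither on `f(ℝ²)` nor in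
the shrunk chart; Milnor's homogeneity lemma (`exists_diffeomorph_apply_eq_forall_isOrientationPreserving`)
moves `x₁` to `x₀`, and data travel along diffeomorphisms
(`Theorems.DcrGfgmw.isSliceDiscInComplement_comp_diffeomorph`). The `D_k`-analogue of the tree's
`Knot.IsSliceDiscIn.exists_notMem_range`. [cite: MilnorTDV1965, §4, Homogeneity Lemma] -/
theorem exists_isSliceDiscInComplement_notMem_range [T2Space X] [IsManifold (𝓡 4) ∞ X]
    [ConnectedSpace X] (h : IsSliceDiscInComplement k K X e f)
    (hK : ∀ t, K t ∈ modelBoundary k) (x₀ : X) :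
    ∃ (e' : EuclideanSpace ℝ (Fin 4) → X) (f' : EuclideanSpace ℝ (Fin 2) → X),
      IsSliceDiscInComplement k K X e' f' ∧ x₀ ∉ range e' ∧ x₀ ∉ range f' := by
  have hR : (0 : ℝ) < 40 * ((k : ℝ) + 1) + 1 := by positivity
  obtain ⟨e₁, he₁, hee₁, hr₁⟩ := exists_isSmoothEmbedding_eqOn_closedBall h.1 hR
  obtain ⟨v, hv, hvf⟩ := exists_lt_norm_apply_notMem_range (m := 2) (n := 4) (X := X)
    (by norm_num) h.1 h.2.1 (8 * (40 * ((k : ℝ) + 1) + 1))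
  obtain ⟨φ, hφ, -⟩ :=
    exists_diffeomorph_apply_eq_forall_isOrientationPreserving (n := 4) (e v) x₀
  have h₁ : IsSliceDiscInComplement k K X e₁ f := isSliceDiscInComplement_congr_chart h hK he₁ hee₁
  refine ⟨φ ∘ e₁, φ ∘ f, Theorems.DcrGfgmw.isSliceDiscInComplement_comp_diffeomorph h₁ φ, ?_, ?_⟩
  · rintro ⟨w, hw⟩
    rw [← hφ] at hw
    obtain ⟨u, hu, hu'⟩ := hr₁ ⟨w, rfl⟩
    have hu1 : u = v := h.1.isEmbedding.injective (hu'.trans (φ.injective hw))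
    rw [mem_ball_zero_iff, hu1] at hu
    linarith
  · rintro ⟨y, hy⟩
    rw [← hφ] at hy
    exact hvf ⟨y, φ.injective hy⟩

/-! ### §2b The transplant through an `S⁴`-embeddable puncture -/

/-- **Transplant.** If the circle `K ⊂ ∂D_k` has a slice datum off `e(D_k)` in a connected smooth
4-manifold `X`, and SOME puncture `X ∖ {q}` embeds smoothly in `S⁴`, then `K` has a slice datum
in `S⁴` (for the composed chart): move the datum off `q`
(`exists_isSliceDiscInComplement_notMem_range`), corestrict to the open submanifold `X ∖ {q}`
(`isSliceDiscInComplement_codRestrict`) and compose with the embedding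
(`Theorems.DcrGfgmw.isSliceDiscInComplement_comp`). First lemma of idea card
`invertible-sphere-transplant`. [cite: FreedmanGompfMorrisonWalker2010, §1] -/
theorem exists_isSliceDiscInComplement_sphere_of_punctureEmbeds [T2Space X]
    [IsManifold (𝓡 4) ∞ X] [ConnectedSpace X] (h : IsSliceDiscInComplement k K X e f)
    (hK : ∀ t, K t ∈ modelBoundary k) (q : X)
    {ι : ↥((⟨{q}ᶜ, isOpen_compl_singleton⟩ : TopologicalSpace.Opens X)) →
      Metric.sphere (0 : EuclideanSpace ℝ (Fin 5)) 1}
    (hι : Manifold.IsSmoothEmbedding (𝓡 4) (𝓡 4) ∞ ι) :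
    ∃ (e' : EuclideanSpace ℝ (Fin 4) → Metric.sphere (0 : EuclideanSpace ℝ (Fin 5)) 1)
      (f' : EuclideanSpace ℝ (Fin 2) → Metric.sphere (0 : EuclideanSpace ℝ (Fin 5)) 1),
      IsSliceDiscInComplement k K (Metric.sphere (0 : EuclideanSpace ℝ (Fin 5)) 1) e' f' := by
  obtain ⟨e₁, f₁, h₁, hqe, hqf⟩ := exists_isSliceDiscInComplement_notMem_range h hK q
  have heU : ∀ v, e₁ v ∈ ((⟨{q}ᶜ, isOpen_compl_singleton⟩ : TopologicalSpace.Opens X)) := by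
    intro v (hv : e₁ v ∈ ({q} : Set X))
    exact hqe ⟨v, hv⟩
  have hfU : ∀ y, f₁ y ∈ ((⟨{q}ᶜ, isOpen_compl_singleton⟩ : TopologicalSpace.Opens X)) := by
    intro y (hy : f₁ y ∈ ({q} : Set X))
    exact hqf ⟨y, hy⟩
  exact ⟨_, _, Theorems.DcrGfgmw.isSliceDiscInComplement_comp
    (isSliceDiscInComplement_codRestrict h₁ _ heU hfU) hι⟩

/-- **Transplant, Euclidean target**: the same with the puncture embedded in `ℝ⁴` — an
equidimensional smooth embedding has open range (it is a local diffeomorphism,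
`Manifold.IsSmoothEmbedding.isLocalDiffeomorph_of_finrank_eq`), so it composes with the round
ball `σ⁻¹ : ℝ⁴ ↪ S⁴` (`isSmoothEmbedding_stereographic'_symm`, `IsSmoothEmbedding.comp_of_isOpen_range`).
[cite: FreedmanGompfMorrisonWalker2010, §1] -/
theorem exists_isSliceDiscInComplement_sphere_of_punctureEmbeds_euclidean [T2Space X]
    [IsManifold (𝓡 4) ∞ X] [ConnectedSpace X] (h : IsSliceDiscInComplement k K X e f)
    (hK : ∀ t, K t ∈ modelBoundary k) (q : X)
    {ι : ↥((⟨{q}ᶜ, isOpen_compl_singleton⟩ : TopologicalSpace.Opens X)) → EuclideanSpace ℝ (Fin 4)}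
    (hι : Manifold.IsSmoothEmbedding (𝓡 4) (𝓡 4) ∞ ι) :
    ∃ (e' : EuclideanSpace ℝ (Fin 4) → Metric.sphere (0 : EuclideanSpace ℝ (Fin 5)) 1)
      (f' : EuclideanSpace ℝ (Fin 2) → Metric.sphere (0 : EuclideanSpace ℝ (Fin 5)) 1),
      IsSliceDiscInComplement k K (Metric.sphere (0 : EuclideanSpace ℝ (Fin 5)) 1) e' f' := by
  letI := Knot.fact_finrank_euclideanSpace_four_add_one
  obtain ⟨a⟩ : Nonempty (Metric.sphere (0 : EuclideanSpace ℝ (Fin 5)) 1) :=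
    ⟨⟨EuclideanSpace.single 0 1, by simp⟩⟩
  have hσ := isSmoothEmbedding_stereographic'_symm (n := 4) a
  have hιo : IsOpen (range ι) :=
    (hι.isLocalDiffeomorph_of_finrank_eq rfl).isOpen_range
  exact exists_isSliceDiscInComplement_sphere_of_punctureEmbeds h hK q
    (IsSmoothEmbedding.comp_of_isOpen_range hσ hι hιo)

end Datum

/-! ### §2c The witnessing sphere of a disproof is exotic and non-invertible -/

/-- **A disproof of the kill switch produces an exotic 4-sphere**: the homotopy sphere `M` of the
slice gap admits no diffeomorphism to `S⁴` (landed `Theorems.DcrGap.Negative.isEmpty_diffeomorph_of_witness`).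
[cite: FreedmanGompfMorrisonWalker2010, §1] -/
theorem exists_exotic_of_not_dcrRigidity (h : ¬ DcrRigidity) :
    ∃ (M : Type) (_ : TopologicalSpace M) (_ : T2Space M) (_ : SecondCountableTopology M)
      (_ : ChartedSpace (EuclideanSpace ℝ (Fin 4)) M) (_ : IsManifold (𝓡 4) ∞ M),
      Nonempty (ContinuousMap.HomotopyEquiv M (Metric.sphere (0 : EuclideanSpace ℝ (Fin 5)) 1)) ∧
        IsEmpty (M ≃ₘ⟮𝓡 4, 𝓡 4⟯ (Metric.sphere (0 : EuclideanSpace ℝ (Fin 5)) 1)) := by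
  obtain ⟨k, K, -, ⟨M, i1, i2, i3, i4, i5, hM, e, f, hef⟩, hno⟩ := not_dcrRigidity_iff.1 h
  exact ⟨M, i1, i2, i3, i4, i5, hM, ⟨fun Φ => hno M ⟨Φ⟩ e f hef⟩⟩

/-- **MAIN: a disproof of the kill switch produces a NON-INVERTIBLE homotopy 4-sphere.** If
`DcrRigidity` fails, the witnessing homotopy sphere `M` of the slice gap is exotic AND no puncture
`M ∖ {q}` of it embeds smoothly in `S⁴`, for any `q` — otherwise the slice datum, moved off `q`,
transplants into `S⁴` (`exists_isSliceDiscInComplement_sphere_of_punctureEmbeds`) and violates the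
no-disc clause at `N := S⁴`. Hence (FGMW §1, fn. 1: `SPC4 ⟺` invertibility `∧ Schoenflies⁴`) any
disproof refutes the invertibility half of SPC4; Schoenflies-type input cannot help it, and
no candidate sphere one of whose punctures embeds in `S⁴` can ever witness the gap.
[cite: FreedmanGompfMorrisonWalker2010, §1] -/
theorem exists_nonInvertible_of_not_dcrRigidity (h : ¬ DcrRigidity) :
    ∃ (M : Type) (_ : TopologicalSpace M) (_ : T2Space M) (_ : SecondCountableTopology M)
      (_ : ChartedSpace (EuclideanSpace ℝ (Fin 4)) M) (_ : IsManifold (𝓡 4) ∞ M),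
      Nonempty (ContinuousMap.HomotopyEquiv M (Metric.sphere (0 : EuclideanSpace ℝ (Fin 5)) 1)) ∧
        IsEmpty (M ≃ₘ⟮𝓡 4, 𝓡 4⟯ (Metric.sphere (0 : EuclideanSpace ℝ (Fin 5)) 1)) ∧
        ∀ (q : M) (ι : ↥((⟨{q}ᶜ, isOpen_compl_singleton⟩ : TopologicalSpace.Opens M)) →
            Metric.sphere (0 : EuclideanSpace ℝ (Fin 5)) 1),
          ¬ Manifold.IsSmoothEmbedding (𝓡 4) (𝓡 4) ∞ ι := by
  obtain ⟨k, K, hK, ⟨M, i1, i2, i3, i4, i5, hM, e, f, hef⟩, hno⟩ := not_dcrRigidity_iff.1 h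
  refine ⟨M, i1, i2, i3, i4, i5, hM, ⟨fun Φ => hno M ⟨Φ⟩ e f hef⟩, fun q ι hι => ?_⟩
  haveI : ConnectedSpace M := by
    haveI := simplyConnectedSpace_of_homotopyEquiv_sphere_four
      simplyConnectedSpace_sphere_four_holds M hM.some
    infer_instance
  have hK' : IsModelKnot k K := hK
  have hef' : IsSliceDiscInComplement k K M e f := hef
  obtain ⟨e', f', h'⟩ :=
    exists_isSliceDiscInComplement_sphere_of_punctureEmbeds hef' hK'.mem q hι
  exact hno _ ⟨Diffeomorph.refl _ _ _⟩ e' f' h'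

/-- **Euclidean form: no puncture of the witnessing sphere embeds in `ℝ⁴`** (the shape of the
punctured-embedding / invertibility statements elsewhere in the tree, e.g. for
Kervaire–Milnor connected sums `M # T ≅ S⁴`). [cite: FreedmanGompfMorrisonWalker2010, §1] -/
theorem exists_nonInvertible_of_not_dcrRigidity_euclidean (h : ¬ DcrRigidity) :
    ∃ (M : Type) (_ : TopologicalSpace M) (_ : T2Space M) (_ : SecondCountableTopology M)
      (_ : ChartedSpace (EuclideanSpace ℝ (Fin 4)) M) (_ : IsManifold (𝓡 4) ∞ M),
      Nonempty (ContinuousMap.HomotopyEquiv M (Metric.sphere (0 : EuclideanSpace ℝ (Fin 5)) 1)) ∧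
        IsEmpty (M ≃ₘ⟮𝓡 4, 𝓡 4⟯ (Metric.sphere (0 : EuclideanSpace ℝ (Fin 5)) 1)) ∧
        ∀ (q : M) (ι : ↥((⟨{q}ᶜ, isOpen_compl_singleton⟩ : TopologicalSpace.Opens M)) →
            EuclideanSpace ℝ (Fin 4)),
          ¬ Manifold.IsSmoothEmbedding (𝓡 4) (𝓡 4) ∞ ι := by
  obtain ⟨k, K, hK, ⟨M, i1, i2, i3, i4, i5, hM, e, f, hef⟩, hno⟩ := not_dcrRigidity_iff.1 h
  refine ⟨M, i1, i2, i3, i4, i5, hM, ⟨fun Φ => hno M ⟨Φ⟩ e f hef⟩, fun q ι hι => ?_⟩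
  haveI : ConnectedSpace M := by
    haveI := simplyConnectedSpace_of_homotopyEquiv_sphere_four
      simplyConnectedSpace_sphere_four_holds M hM.some
    infer_instance
  have hK' : IsModelKnot k K := hK
  have hef' : IsSliceDiscInComplement k K M e f := hef
  obtain ⟨e', f', h'⟩ :=
    exists_isSliceDiscInComplement_sphere_of_punctureEmbeds_euclidean hef' hK'.mem q hι
  exact hno _ ⟨Diffeomorph.refl _ _ _⟩ e' f' h'

/-- **INVERTIBILITY WOULD PROVE THE CRUX; a disproof refutes it.** If every smooth homotopy
4-sphere (Statement binders) has SOME puncture that embeds smoothly in `ℝ⁴` ("every homotopy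
4-sphere is invertible", the non-Schoenflies half of SPC4 in Freedman–Gompf–Morrison–Walker's
splitting), then `DcrRigidity` holds; stated negatively, as befits this file.
[cite: FreedmanGompfMorrisonWalker2010, §1] -/
theorem not_forall_punctureEmbeds_of_not_dcrRigidity (h : ¬ DcrRigidity) :
    ¬ ∀ (M : Type) [TopologicalSpace M] [T2Space M] [SecondCountableTopology M]
        [ChartedSpace (EuclideanSpace ℝ (Fin 4)) M] [IsManifold (𝓡 4) ∞ M],
        Nonempty (ContinuousMap.HomotopyEquiv M (Metric.sphere (0 : EuclideanSpace ℝ (Fin 5)) 1)) →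
          ∃ (q : M) (ι : ↥((⟨{q}ᶜ, isOpen_compl_singleton⟩ : TopologicalSpace.Opens M)) →
              EuclideanSpace ℝ (Fin 4)),
            Manifold.IsSmoothEmbedding (𝓡 4) (𝓡 4) ∞ ι := by
  intro hinv
  obtain ⟨M, i1, i2, i3, i4, i5, hM, -, hq⟩ := exists_nonInvertible_of_not_dcrRigidity_euclidean h
  obtain ⟨q, ι, hι⟩ := @hinv M i1 i2 i3 i4 i5 hM
  exact hq q ι hι


/-! ## §3 The genuinely load-bearing hypotheses — near-misses

Both `_false_without_` statements below are TRUE IN PRINT and recorded with `sorry` (permitted in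
this work file only); the obstruction is the same for both: the tree has no unconditional proof
that ANY knot fails to be slice (in `B⁴`, let alone in `♮ᵏ(B² × S²)`).  They are stated so that a
later seat can close them the day a slice obstruction is discharged (e.g. Rasmussen's
`eq_zero_of_isSmoothlySlice` together with `s(T(2,3)) = 2`, plus ONE explicit disc). -/

/-- The kill switch with the HOMOTOPY-SPHERE hypothesis on the carrier of the datum DROPPED: every
circle on `∂D_k` that is slice off `e(D_k)` in SOME smooth 4-manifold whatsoever bounds a model
slice disc. [folklore] -/
def RigidityWithoutHomotopySphere : Prop :=
  ∀ (k : ℕ) (K : (Metric.sphere (0 : EuclideanSpace ℝ (Fin 2)) 1) → EuclideanSpace ℝ (Fin 4)),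
    IsModelKnot k K →
    (∃ (M : Type) (_ : TopologicalSpace M) (_ : T2Space M) (_ : SecondCountableTopology M)
        (_ : ChartedSpace (EuclideanSpace ℝ (Fin 4)) M) (_ : IsManifold (𝓡 4) ∞ M),
        ∃ (e : EuclideanSpace ℝ (Fin 4) → M) (f : EuclideanSpace ℝ (Fin 2) → M),
          IsSliceDiscInComplement k K M e f) →
    ∃ g, IsModelSliceDisc k K g

/-- **NEAR-MISS: `M ≃ₕ S⁴` is load-bearing** — `RigidityWithoutHomotopySphere` is FALSE: the
right-handed trefoil `T`, rescaled onto `∂D_0` (`Theorems.DcrGap.Negative.isModelKnot_scaling_comp`), is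
slice off `D_0 = L(B̄⁴)` in `M = ℂℙ̄² ∖ pt` or `(S² × S²) ∖ pt` (unknotting number one / Norman's
trick: tube the immersed disc into the core sphere; Norman 1969, Gompf–Stipsicz Ex. 2.2.9), but
bounds no disc in `B⁴` (`s(T) = 2 ≠ 0`, Rasmussen 2010 Thm. 1; classically signature `-2`), hence
no model slice disc at `k = 0` (landed dictionary `isSliceDiscIn_of_isSliceDiscInComplement_zero`
+ Palais).  OBSTRUCTION TO CLOSING IT HERE: (a) no knot is proved non-slice in the tree
(`Knot.Rasmussen.eq_zero_of_isSmoothlySlice` is an undischarged named fact); (b) the Norman disc in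
`ℂℙ̄² ∖ pt` would have to be written as an explicit smooth embedding.  Tried: searching the tree for
`not_isSmoothlySlice` / signature obstructions (none discharged). [cite: Rasmussen2010, Thm. 1] -/
theorem rigidity_false_without_homotopySphere : ¬ RigidityWithoutHomotopySphere := by
  sorry

/-- The kill switch with the AVOIDANCE clause `f(𝔻°) ∩ e(D_k) = ∅` of the HYPOTHESIS datum dropped
(kept in the conclusion): every model knot bounding a smooth embedded disc in some homotopy
4-sphere — the disc being allowed to pass through `e(D_k)` — bounds a model slice disc. [folklore] -/
def RigidityWithoutAvoidance : Prop :=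
  ∀ (k : ℕ) (K : (Metric.sphere (0 : EuclideanSpace ℝ (Fin 2)) 1) → EuclideanSpace ℝ (Fin 4)),
    IsModelKnot k K →
    (∃ (M : Type) (_ : TopologicalSpace M) (_ : T2Space M) (_ : SecondCountableTopology M)
        (_ : ChartedSpace (EuclideanSpace ℝ (Fin 4)) M) (_ : IsManifold (𝓡 4) ∞ M),
        Nonempty (ContinuousMap.HomotopyEquiv M (Metric.sphere (0 : EuclideanSpace ℝ (Fin 5)) 1)) ∧
        ∃ (e : EuclideanSpace ℝ (Fin 4) → M) (f : EuclideanSpace ℝ (Fin 2) → M),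
          Manifold.IsSmoothEmbedding (𝓡 4) (𝓡 4) ∞ e ∧ ContMDiff (𝓡 2) (𝓡 4) ∞ f ∧
          InjOn f (closedBall 0 1) ∧ (∀ x ∈ closedBall (0 : EuclideanSpace ℝ (Fin 2)) 1,
            Injective (mfderiv (𝓡 2) (𝓡 4) f x)) ∧
          ∀ t : Metric.sphere (0 : EuclideanSpace ℝ (Fin 2)) 1, f t = e (K t)) →
    ∃ g, IsModelSliceDisc k K g

/-- **NEAR-MISS: the avoidance clause is load-bearing** — `RigidityWithoutAvoidance` is FALSE:
EVERY model knot satisfies the weakened hypothesis in `M = S⁴` (a smooth circle in `ℝ⁴` is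
smoothly unknotted, `2·1 + 2 ≤ 4`, so it bounds a smooth embedded disc in `ℝ⁴ ⊂ S⁴`, possibly
through `D_k`), so the statement says "every model knot is slice in `♮ᵏ(B² × S²)`", refuted by a
trefoil in a 3-ball of `∂D_k` (MMSW Lemma 8.19: a disc forces `s₋ ≤ 0`, but `s₋ = s(T) = 2` for
the local right-handed trefoil; at `k = 0` simply: the trefoil is not slice).  OBSTRUCTION: as
above, (a) no discharged slice obstruction in the tree, (b) an explicit smooth disc in `ℝ⁴`
bounded by the rescaled trefoil (e.g. an isotopy to the round circle followed by the flat disc)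
would have to be formalised. [cite: ManolescuMarengonSarkarWillis2023, Lemma 8.19] -/
theorem rigidity_false_without_avoidance : ¬ RigidityWithoutAvoidance := by
  sorry

/-- What §3 needs, isolated as ONE hypothesis: an FGMW-type pair at `k = 0` already refutes
`RigidityWithoutHomotopySphere` — if some knot is slice in SOME smooth 4-manifold's ball
complement (`Knot.IsSliceDiscIn`) but not in `B⁴`, the homotopy-sphere-free rigidity fails.
PROVED (modulo nothing): the landed `k = 0` dictionary turns the datum into a `k = 0` model datum,
the weakened rigidity hands back a model slice disc, which Palais + neatening turn into a slice
disc in `B⁴`. So `rigidity_false_without_homotopySphere` reduces exactly to exhibiting such a pair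
(trefoil in `ℂℙ̄² ∖ pt`). [cite: Palais1960, Thm. B] -/
theorem rigidityWithoutHomotopySphere_false_of_pair (K₀ : Knot) {X : Type} [TopologicalSpace X]
    [T2Space X] [SecondCountableTopology X] [ChartedSpace (EuclideanSpace ℝ (Fin 4)) X]
    [IsManifold (𝓡 4) ∞ X] {e : EuclideanSpace ℝ (Fin 4) → X} {f : EuclideanSpace ℝ (Fin 2) → X}
    (hX : K₀.IsSliceDiscIn X e f) (hns : ¬ K₀.IsSmoothlySlice) :
    ¬ RigidityWithoutHomotopySphere := by
  intro hR
  obtain ⟨L, hL⟩ := Theorems.DcrGap.Negative.exists_scaling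
  have hD := Theorems.DcrGap.Negative.scaling_mem_modelHandlebody_zero_iff hL
  have hmk := Theorems.DcrGap.Negative.isModelKnot_scaling_comp hL K₀
  have hdat := Theorems.DcrGap.Negative.isSliceDiscInComplement_zero_of_isSliceDiscIn hD hX
  obtain ⟨g, hg⟩ := hR 0 _ hmk ⟨X, _, ‹_›, ‹_›, _, ‹_›, _, f, hdat⟩
  -- push the model disc into `S⁴`, un-scale, Palais' complementary ball, neatening
  have hS := hg.isSliceDiscInComplement_chartAt_symm
    (⟨EuclideanSpace.single 0 1, by simp⟩ : Metric.sphere (0 : EuclideanSpace ℝ (Fin 5)) 1)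
  have hIn := Theorems.DcrGap.Negative.isSliceDiscIn_of_isSliceDiscInComplement_zero hD hS
  obtain ⟨U, c, hc₁, hc₂⟩ := Knot.palais_ballComplement_sphere_four_holds _ hIn.isSmoothEmbedding
  obtain ⟨g', hg'⟩ := hIn.exists_isProperDisc c hc₁ hc₂
  exact hns (Knot.isSmoothlySlice_of_isProperDisc_holds K₀ g' hg')

/-! ## §4 Why it resists; attack log (prose)

* SANDWICH.  `SmoothPoincare4 ⇒ INV ⇒ DcrRigidity ⇒ (every H-slice knot is slice)`:
  the first arrow is FGMW's observation, the second is `not_forall_punctureEmbeds_of_not_dcrRigidity`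
  (§2), the third is the sibling's `Theorems.DcrGap.Negative.isSmoothlySlice_of_isHomotopyBallSlice_of_not_dcrGap`.
  All four statements are OPEN (Manolescu, arXiv:2601.05425 §7 p. 24; MMSW §9.3, Question 9.11;
  Manolescu–Piccirillo 2023 §1).  A DISPROOF of the crux therefore lives strictly between "some
  H-slice knot is not slice" (which implies it, §0) and "some homotopy 4-sphere is not invertible"
  (which it implies, §2): it is an exotic-`S⁴` theorem of FGMW type and nothing less.
* NO JUNK.  The classes quantified over are honest: `Manifold.IsSmoothEmbedding` = immersion +
  topological embedding (not closed), so charts `ℝ⁴ ↪ M` into compact `M` exist (round chart);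
  the guard `1 ≤ |z - c_j|²` keeps `1/0` out of `D_k`; the `k = 0` class is exactly the class of
  H-slice data of knots (landed dictionary) and is inhabited (§1d); the homotopy sphere of a datum
  is automatically connected / simply connected / compact (tree facts), so no degenerate carrier
  (empty, disconnected, non-compact) sneaks into either side.
* MUTATION SUMMARY (hypothesis ↦ effect of dropping it on the `∀`-form):
  `IsModelKnot` regularity ↦ none (§1a–b, proved) · membership `K ⊂ ∂D_k` ↦ used only as
  `K ⊂ B̄(0,R)`; dropping it entirely changes the problem (circles inside `D_k°` have no datum,
  circles outside need a separating disc) but gives no cheap kill · `M ≃ₕ S⁴` ↦ FALSE in print,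
  unprovable here (§3) · avoidance ↦ FALSE in print, unprovable here (§3) · smooth/injective/
  immersed clauses of the disc ↦ dropping injectivity makes BOTH hypothesis and conclusion
  trivial (immersed discs always exist in the simply connected `♮ᵏ(B² × S²)`), i.e. the statement
  becomes true and uninformative · conclusion `≃ₘ ↦ ≃ₕ` ↦ trivially true (§1) · conclusion
  `N, e'` free ↦ fixing them to `S⁴`, round chart changes nothing (§1c).
* DEGENERATE REGIMES.  `k = 0`: the crux restricted to `k = 0` is "H-slice ⇒ slice" (open).
  `k = 1`: winding `±1` circles are never witnesses (Davis–Nagel–Park–Ray 2018 Thm. 1.1: concordant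
  to `S¹ × pt` in `S¹ × S²`, hence slice in `B² × S²`) — constrains disproofs to winding `0` or
  `|w| ≥ 2` (card `dual-sphere-norman-sector` generalises this to primitive winding vectors at all
  `k`); not typed (no concordance-in-`S¹ × S²` vocabulary in the tree).  Large `k`: no new
  phenomenon is visible at the level of the statement (the model constants keep the holes
  disjoint for all `k`: saddle values of the planar potential `≤ π²/16 + 0.01 < 1`).
* CANDIDATE SUPPLY FOR A KILL (the engine's business, recorded for the lead): by §2 only
  NON-INVERTIBLE candidates can work, so before any Khovanov computation on a candidate `Σ` drawn
  with dotted circles one should try to embed `Σ ∖ pt` in `ℝ⁴` (e.g. `Σ° ∪ 2-handles ≅ ♮(S² × B²)`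
  certificates, Kirby LNM 1374 p. 14); every success voids the candidate for this crux for free.
* LITERATURE (2026-08-16/17; searches logged in the session notes): no `M_k`-rigidity theorem
  ("slice in a homotopy `♮ᵏ(B² × S²)` ⇒ slice in `♮ᵏ(B² × S²)`") and no counterexample is in
  print; MMSW compute `s_±` only for families where the answer is forced (Gluck twists, Cor. 1.13);
  FGMW's own Cappell–Shaneson candidates were shown standard (Akbulut 2010, Gompf 2010).  Nothing
  to import as a kill; nothing that proves the crux either.
-/

end Summit.SmoothPoincare4.SmoothPoincare4.Cruxes.DcrRigidity.Disproof

end
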